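import Mathlib
import HarnessLib.Audit
import Summits.PneNP.PneNP.Theorems.ClusOshDown

/-!
# Route ClusUniversalCertificate — the order-shattered family is a down-closed shattered subcomplex; `(SH-RUNG) ⟹ (OSH-RUNG)` off `Y = V` (osh-P2.md F1(a), F6)
(rung F-N1, cell pnp-ideate, crux `UniversalCertAll` = stmt-PneNP-19683; planner p1 g14, `lines/osh-P2.md` F1(a) "osh(Y) is a down-set", F6 "every osh_π(Y) = D_π(Y)
is such a 𝒯, so (SH-RUNG) ⇒ (OSH-RUNG)"; restricted-model combinatorics — nothing here bears on `P` versus `NP`)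

* `colexStd_erase` — the colex-standard sets form a DOWN-SET (multiply a dependence by `x_i`; `x_i² = x_i` on `𝔽₂`-points); `isLowerSet_oshDown`;
* `shatterer_downAll_subset`, `oshDown_subset_shatterer` (p1's glue: Mathlib's `shatterer_compress_subset_shatterer` + `subset_shatterer`);
* `oshRungDown_of_shRung` — `ShRung N` gives the downshift one-block rung for every `Y ≠ V` (and hence `OshRung` there, by `ClusOshDown.oshRungDown_iff_oshRung`).
-/

set_option linter.dupNamespace false -- `Summit.PneNP.PneNP.…`: summit = sub-problem name (D-0017 single-conjunct layout)

namespace Summit.PneNP.PneNP.Theorems.ClusHilbert.Osh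

open Finset
open scoped FinsetFamily
open Summit.PneNP.PneNP.Theorems.ClusCube (V)
open Summit.PneNP.PneNP.Theorems.ClusHilbert (chi resTo dimAt)

variable {N : ℕ}

/-! ## The standard sets form a down-set -/

/-- `χ_{S ∪ {i}} = x_i · χ_S` on `𝔽₂`-points (whether or not `i ∈ S`, since `x_i² = x_i`). -/
theorem chi_insert_apply (S : Finset (Fin N)) (i : Fin N) (y : V N) : chi (insert i S) y = y i * chi S y := by
  classical
  unfold ClusHilbert.chi
  by_cases hi : i ∈ S
  · rw [insert_eq_of_mem hi, ← mul_prod_erase S _ hi, ← mul_assoc]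
    congr 1
    rcases (by decide : ∀ z : ZMod 2, z = 0 ∨ z = 1) (y i) with h | h <;> simp [h]
  · rw [prod_insert hi]

/-- Inserting a common new element preserves the colex order. -/
theorem insert_lt_insert_of_lt {S T : Finset (Fin N)} {i : Fin N} (hS : i ∉ S) (hT : i ∉ T) (h : toColex S < toColex T) :
    toColex (insert i S) < toColex (insert i T) := by
  have key := Colex.toColex_sdiff_lt_toColex_sdiff (singleton_subset_iff.2 (mem_insert_self i S)) (singleton_subset_iff.2 (mem_insert_self i T))
  rw [sdiff_singleton_eq_erase, sdiff_singleton_eq_erase, erase_insert hS, erase_insert hT] at key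
  exact key.1 h

/-- **The colex-standard sets form a down-set**: `T` standard, `i ∈ T` ⟹ `T ∖ i` standard. -/
theorem colexStd_erase (Y : Finset (V N)) {T : Finset (Fin N)} (hT : colexStd Y T) {i : Fin N} (hi : i ∈ T) : colexStd Y (T.erase i) := by
  classical
  intro hdep
  apply hT
  -- multiply the dependence of `χ_{T∖i}` by `x_i`
  let μ : (Y → ZMod 2) →ₗ[ZMod 2] (Y → ZMod 2) :=
    { toFun := fun f y => y.1 i * f y
      map_add' := fun f g => by funext y; simp only [Pi.add_apply]; ring
      map_smul' := fun c f => by funext y; simp only [Pi.smul_apply, smul_eq_mul, RingHom.id_apply]; ring }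
  have hμ : ∀ S : Finset (Fin N), μ (resTo Y (chi S)) = resTo Y (chi (insert i S)) := by
    intro S; funext y; exact (chi_insert_apply S i y.1).symm
  have h := Submodule.mem_map_of_mem (f := μ) hdep
  rw [hμ, insert_erase hi, Submodule.map_span] at h
  refine (Submodule.span_le.2 ?_) h
  rintro _ ⟨_, ⟨S, hS, rfl⟩, rfl⟩
  rw [Set.mem_setOf_eq] at hS
  rw [hμ]
  refine Submodule.subset_span ⟨insert i S, ?_, rfl⟩
  rw [Set.mem_setOf_eq]
  by_cases hiS : i ∈ S
  · rw [insert_eq_of_mem hiS]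
    exact hS.trans (Colex.toColex_lt_toColex_of_ssubset (erase_ssubset hi))
  · have := insert_lt_insert_of_lt hiS (notMem_erase i T) hS
    rwa [insert_erase hi] at this

/-- **The order-shattered family is down-closed.** -/
theorem isLowerSet_oshDown (Y : Finset (V N)) : IsLowerSet (oshDown Y : Set (Finset (Fin N))) := by
  classical
  intro T S hST hT
  rw [mem_coe, ← colexStd_iff_mem_oshDown] at hT ⊢
  -- peel `T ∖ S` one element at a time
  suffices key : ∀ (k : ℕ) (T : Finset (Fin N)), (T \ S).card = k → S ⊆ T → colexStd Y T → colexStd Y S from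
    key _ T rfl hST hT
  intro k
  induction k with
  | zero =>
    intro T hk hST hT
    rw [card_eq_zero, sdiff_eq_empty_iff_subset] at hk
    rwa [← Subset.antisymm hk hST]
  | succ k ih =>
    intro T hk hST hT
    obtain ⟨i, hi⟩ : (T \ S).Nonempty := card_pos.1 (by omega)
    rw [mem_sdiff] at hi
    refine ih (T.erase i) ?_ (fun j hj => mem_erase.2 ⟨fun h => hi.2 (h ▸ hj), hST hj⟩) (colexStd_erase Y hT hi.1)
    rw [erase_sdiff_comm, card_erase_of_mem (mem_sdiff.2 hi), hk]
    rfl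

/-! ## Shattering -/

/-- Down-compressions only shrink the shatterer (Mathlib, iterated). -/
theorem shatterer_downAll_subset (l : List (Fin N)) (𝒜 : Finset (Finset (Fin N))) : (downAll l 𝒜).shatterer ⊆ 𝒜.shatterer := by
  induction l generalizing 𝒜 with
  | nil => exact Subset.refl _
  | cons a l ih => exact (ih _).trans (shatterer_compress_subset_shatterer a 𝒜)

/-- **`oshDown Y` is shattered by the supports of `Y`** (p1's glue `oshDown_subset_shatterer`). -/
theorem oshDown_subset_shatterer (Y : Finset (V N)) : oshDown Y ⊆ (Y.image supp).shatterer :=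
  (subset_shatterer (isLowerSet_oshDown Y)).trans (shatterer_downAll_subset _ _)

/-- **`(SH-RUNG) ⟹` the downshift one-block rung off `Y = V`.** -/
theorem oshRungDown_of_shRung {N : ℕ} (h : ShRung N) (Y : Finset (V N)) (hY : Y ≠ univ) :
    ∑ s ∈ oshDown Y, s.card + ∑ y ∈ Y, dimAt Y y ≤ (N - 1) * Y.card + ∑ y ∈ Y, lexIncr Y y :=
  h Y hY (oshDown Y) (oshDown_subset_shatterer Y) (isLowerSet_oshDown Y) (card_oshDown Y)

/-- Hence `(SH-RUNG)` gives the span form `(OSH-RUNG)` for every `Y ≠ V`. -/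
theorem oshRung_of_shRung {N : ℕ} (h : ShRung N) (Y : Finset (V N)) (hY : Y ≠ univ) :
    oshS Y + ∑ y ∈ Y, dimAt Y y ≤ (N - 1) * Y.card + ∑ y ∈ Y, lexIncr Y y := by
  rw [oshS_eq_weight]
  exact oshRungDown_of_shRung h Y hY

end Summit.PneNP.PneNP.Theorems.ClusHilbert.Osh
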